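import Mathlib.Analysis.SpecialFunctions.Pow.Real
import Mathlib.Analysis.Complex.Basic
import Mathlib.Algebra.BigOperators.Ring.Finset
import HarnessLib

/-!
# The diagonal of the Balasubramanian–Conrey–Heath-Brown mean square: reindexing the coincidences
# `nh = n'k` by `(h, k, ℓ)`, `n = ℓ·k/(h,k)`, `n' = ℓ·h/(h,k)`

Topic `Literature/NumberTheory/LFunctions`. Everything in this file is PROVED (no named facts; the only
definition is the transparent coefficient `BCH.diagCoeff`).

## Context

In the evaluation of `∫_T^{2T} |ζ(½+it)|² |A(½+it)|² dt` (`A(s) = Σ_{h ≤ N} a_h h^{-s}`; the named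
fact `Literature.Barriers.RiemannHypothesis.BalasubramanianConreyHeathBrown1985_meanSquare`) along
Titchmarsh §7.4 / Levinson §4, the product of the approximate functional equation sum
`Σ_{n ≤ √(t/2π)} n^{-1/2-it}` (of `t`-dependent length) with `A(½+it)` is an "activated" Dirichlet
polynomial over the index set `S = [1, N'] × [1, N]` of pairs `i = (n, h)`: coefficient
`x_i = a_h (nh)^{-1/2}`, frequency `μ_i = nh`, activation time `τ_i = 2πn²`. The mean value theorem
`Literature.NumberTheory.LFunctions.DirichletMVT.norm_weighted_meanSquare_activated_sub_le_crude`
leaves the diagonal `Σ_{i ∈ S} Σ_{j ∈ S, μ_j = μ_i} x_i x̄_j ∫_T^{2T} [τ_i ≤ t][τ_j ≤ t] dt`, a sum over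
the **coincidences** `n'k = nh`. Writing `g = (h,k)`, `h = g h'`, `k = g k'`, the coincidences are
exactly `n = ℓ k'`, `n' = ℓ h'`, `ℓ ≥ 1` (Levinson 1974, §4; in the tree
`Literature.NumberTheory.LFunctions.LevinsonSums.div_gcd_dvd_of_dvd_mul` is the same divisibility),
with `nh = n'k = ℓ [h,k]` and `max(n, n') = ℓ max(h', k')`. This file performs the reindexing:

* `BCH.mul_eq_mul_iff_exists` — `nh = n'k ↔ ∃ ℓ, n = ℓk' ∧ n' = ℓh'`;
* `BCH.sum_sum_filter_coincidence_eq` — for fixed `h, k ≥ 1`: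
  `Σ_{n ≤ N'} Σ_{n' ≤ N', n'k = nh} G(n, n') = Σ_{ℓ ≤ N'/max(h',k')} G(ℓk', ℓh')`;
* `BCH.sum_coincidence_reindex` — the diagonal over `S = [1,N'] × [1,N]` as
  `Σ_{h,k ≤ N} Σ_{ℓ ≤ N'/max(h',k')} Φ((ℓk', h), (ℓh', k))`;
* `BCH.diagCoeff_mul_conj` — with `x_{(n,h)} = a_h (nh)^{-1/2}`:
  `x_{(ℓk',h)} x̄_{(ℓh',k)} = a_h ā_k / (ℓ [h,k])`;
* `BCH.sum_coincidence_diag_eq` — **the diagonal in closed form**: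
  `Σ_{i ∈ S} Σ_{j ∈ S, μ_j = μ_i} x_i x̄_j (2T − max(T, 2π max(n,n')²))⁺`
  `  = Σ_{h,k ≤ N} (a_h ā_k/[h,k]) · Σ_{ℓ ≤ N'/M_{hk}} ℓ⁻¹ (2T − max(T, 2πℓ²M_{hk}²))⁺`, `M_{hk} = max(h',k')`,
  i.e. `Σ_{h,k} (a_h ā_k/[h,k]) D_{N'/M_{hk}}(M_{hk}, T)` with the diagonal sum `D_L(M,T)` of
  `Literature/NumberTheory/LFunctions/BCHDiagonalSum.lean` (evaluated there as
  `T(½ log(T/(2πM²)) + γ + log 2 − ½) + O(M²)`).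

## References

* [Titchmarsh1986] E. C. Titchmarsh, *The Theory of the Riemann Zeta-Function*, 2nd ed. (1986), §7.4
  (diagonal `m = n` of the mean square of the approximate functional equation).
* [Levinson1974] N. Levinson, Adv. Math. 13 (1974), 383–436, §4 (the coincidences `kn = k'n'` of the
  mollified mean square).
* [BettinChandeeRadziwill2017] S. Bettin, V. Chandee, M. Radziwiłł, J. reine angew. Math. 729 (2017),
  §3.1 ("Diagonal terms": `m_j = ℓ n_j/(n_1,n_2)`), eq. (1.2).
-/

noncomputable section

open Finset
open scoped ComplexConjugate

namespace Literature.NumberTheory.LFunctions.BCH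

/-! ### The coincidences `nh = n'k` -/

/-- `h = (h,k)·(h/(h,k))` for `h, k` (a `Nat.div_mul_cancel` restatement). [folklore] -/
theorem gcd_mul_div_left (h k : ℕ) : Nat.gcd h k * (h / Nat.gcd h k) = h :=
  Nat.mul_div_cancel' (Nat.gcd_dvd_left h k)

/-- `k = (h,k)·(k/(h,k))`. [folklore] -/
theorem gcd_mul_div_right (h k : ℕ) : Nat.gcd h k * (k / Nat.gcd h k) = k :=
  Nat.mul_div_cancel' (Nat.gcd_dvd_right h k)

/-- For `h ≥ 1` the reduced numerator `h/(h,k)` is `≥ 1`. [folklore] -/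
theorem div_gcd_pos_left {h : ℕ} (k : ℕ) (hh : 0 < h) : 0 < h / Nat.gcd h k :=
  Nat.div_pos (Nat.le_of_dvd hh (Nat.gcd_dvd_left h k)) (Nat.gcd_pos_of_pos_left k hh)

/-- For `k ≥ 1` the reduced denominator `k/(h,k)` is `≥ 1`. [folklore] -/
theorem div_gcd_pos_right (h : ℕ) {k : ℕ} (hk : 0 < k) : 0 < k / Nat.gcd h k :=
  Nat.div_pos (Nat.le_of_dvd hk (Nat.gcd_dvd_right h k)) (Nat.gcd_pos_of_pos_right h hk)

/-- **The coincidences.** For `h, k ≥ 1` with `g = (h,k)`, `h' = h/g`, `k' = k/g`: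
`n·h = n'·k ↔ ∃ ℓ, n = ℓ k' ∧ n' = ℓ h'` (Levinson §4: `k' ∣ kn` forces `k'/(k,k') ∣ n`).
[cite: Levinson1974, §4] -/
theorem mul_eq_mul_iff_exists {h k : ℕ} (hh : 0 < h) (hk : 0 < k) (n n' : ℕ) :
    n * h = n' * k ↔ ∃ ℓ : ℕ, n = ℓ * (k / Nat.gcd h k) ∧ n' = ℓ * (h / Nat.gcd h k) := by
  set g := Nat.gcd h k with hg
  set h' := h / g with hh'
  set k' := k / g with hk'
  have hg0 : 0 < g := Nat.gcd_pos_of_pos_left k hh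
  have eh : g * h' = h := gcd_mul_div_left h k
  have ek : g * k' = k := gcd_mul_div_right h k
  have hk'0 : 0 < k' := div_gcd_pos_right h hk
  have hcop : Nat.Coprime h' k' := Nat.coprime_div_gcd_div_gcd hg0
  constructor
  · intro e
    -- cancel `g`: `n h' = n' k'`
    have e' : n * h' = n' * k' := by
      apply Nat.eq_of_mul_eq_mul_left hg0
      calc g * (n * h') = n * (g * h') := by ring
        _ = n * h := by rw [eh]
        _ = n' * k := e
        _ = n' * (g * k') := by rw [ek]
        _ = g * (n' * k') := by ring
    have hdvd : k' ∣ n * h' := ⟨n', by rw [e']; ring⟩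
    obtain ⟨ℓ, hℓ⟩ := hcop.symm.dvd_of_dvd_mul_right hdvd
    refine ⟨ℓ, by rw [hℓ]; ring, ?_⟩
    apply Nat.eq_of_mul_eq_mul_right hk'0
    calc n' * k' = n * h' := e'.symm
      _ = ℓ * h' * k' := by rw [hℓ]; ring
  · rintro ⟨ℓ, rfl, rfl⟩
    calc ℓ * k' * h = ℓ * k' * (g * h') := by rw [eh]
      _ = ℓ * h' * (g * k') := by ring
      _ = ℓ * h' * k := by rw [ek]

/-- `ℓ · max(a, b) ≤ N ↔ ℓa ≤ N ∧ ℓb ≤ N` in `ℕ`. [folklore] -/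
theorem mul_max_le_iff (ℓ a b N : ℕ) : ℓ * max a b ≤ N ↔ ℓ * a ≤ N ∧ ℓ * b ≤ N := by
  rcases le_total a b with hab | hab
  · rw [max_eq_right hab]
    exact ⟨fun h => ⟨le_trans (Nat.mul_le_mul_left ℓ hab) h, h⟩, fun h => h.2⟩
  · rw [max_eq_left hab]
    exact ⟨fun h => ⟨h, le_trans (Nat.mul_le_mul_left ℓ hab) h⟩, fun h => h.1⟩

/-! ### Reindexing the coincidences for a fixed pair `(h, k)` -/

/-- **Reindexing for fixed `h, k ≥ 1`.** With `h' = h/(h,k)`, `k' = k/(h,k)`, `M = max(h', k')`: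
`Σ_{n ≤ N'} Σ_{n' ≤ N', n'k = nh} G(n, n') = Σ_{1 ≤ ℓ ≤ N'/M} G(ℓk', ℓh')` — the map
`ℓ ↦ (ℓk', ℓh')` is a bijection from `[1, N'/M]` onto the coincidences in `[1,N']²`.
[cite: Levinson1974, §4] -/
theorem sum_sum_filter_coincidence_eq {α : Type*} [AddCommMonoid α] {h k : ℕ} (hh : 0 < h)
    (hk : 0 < k) (N' : ℕ) (G : ℕ → ℕ → α) :
    ∑ n ∈ Finset.Icc 1 N', ∑ n' ∈ (Finset.Icc 1 N').filter (fun n' => n' * k = n * h), G n n' =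
      ∑ ℓ ∈ Finset.Icc 1 (N' / max (h / Nat.gcd h k) (k / Nat.gcd h k)),
        G (ℓ * (k / Nat.gcd h k)) (ℓ * (h / Nat.gcd h k)) := by
  set g := Nat.gcd h k with hg
  set h' := h / g with hh'
  set k' := k / g with hk'
  set M := max h' k' with hM
  have hh'0 : 0 < h' := div_gcd_pos_left k hh
  have hk'0 : 0 < k' := div_gcd_pos_right h hk
  have hM0 : 0 < M := lt_of_lt_of_le hh'0 (le_max_left _ _)
  -- the left side as a sum over the filtered product
  set P : Finset (ℕ × ℕ) :=
    ((Finset.Icc 1 N') ×ˢ (Finset.Icc 1 N')).filter (fun p => p.2 * k = p.1 * h) with hP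
  have eR : ∑ p ∈ P, G p.1 p.2 =
      ∑ n ∈ Finset.Icc 1 N', ∑ n' ∈ Finset.Icc 1 N', if n' * k = n * h then G n n' else 0 := by
    rw [hP, Finset.sum_filter, Finset.sum_product]
  have eL : ∑ n ∈ Finset.Icc 1 N', ∑ n' ∈ (Finset.Icc 1 N').filter (fun n' => n' * k = n * h),
      G n n' = ∑ n ∈ Finset.Icc 1 N', ∑ n' ∈ Finset.Icc 1 N', if n' * k = n * h then G n n' else 0 := by
    refine Finset.sum_congr rfl fun n _ => ?_
    rw [Finset.sum_filter]
  have hL : ∑ n ∈ Finset.Icc 1 N', ∑ n' ∈ (Finset.Icc 1 N').filter (fun n' => n' * k = n * h),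
      G n n' = ∑ p ∈ P, G p.1 p.2 := eL.trans eR.symm
  -- the right side as a sum over the image of `ℓ ↦ (ℓk', ℓh')`
  set φ : ℕ → ℕ × ℕ := fun ℓ => (ℓ * k', ℓ * h') with hφ
  have hinj : Set.InjOn φ (Finset.Icc 1 (N' / M) : Set ℕ) := by
    intro x _ y _ hxy
    have h1 : x * k' = y * k' := congrArg Prod.fst hxy
    exact Nat.eq_of_mul_eq_mul_right hk'0 h1
  have hR : ∑ ℓ ∈ Finset.Icc 1 (N' / M), G (ℓ * k') (ℓ * h') =
      ∑ p ∈ (Finset.Icc 1 (N' / M)).image φ, G p.1 p.2 := by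
    rw [Finset.sum_image hinj]
  -- the image is the coincidence set
  have himg : (Finset.Icc 1 (N' / M)).image φ = P := by
    ext ⟨n, n'⟩
    simp only [Finset.mem_image, Finset.mem_Icc, hP, Finset.mem_filter, Finset.mem_product, hφ,
      Prod.mk.injEq]
    constructor
    · rintro ⟨ℓ, ⟨hℓ1, hℓ2⟩, rfl, rfl⟩
      rw [Nat.le_div_iff_mul_le hM0, mul_max_le_iff] at hℓ2
      refine ⟨⟨⟨Nat.one_le_iff_ne_zero.2 (Nat.mul_ne_zero (by omega) hk'0.ne'), hℓ2.2⟩,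
        ⟨Nat.one_le_iff_ne_zero.2 (Nat.mul_ne_zero (by omega) hh'0.ne'), hℓ2.1⟩⟩, ?_⟩
      exact ((mul_eq_mul_iff_exists hh hk (ℓ * k') (ℓ * h')).2 ⟨ℓ, rfl, rfl⟩).symm
    · rintro ⟨⟨⟨hn1, hnN⟩, ⟨hn'1, hn'N⟩⟩, he⟩
      obtain ⟨ℓ, rfl, rfl⟩ := (mul_eq_mul_iff_exists hh hk n n').1 he.symm
      refine ⟨ℓ, ⟨?_, ?_⟩, rfl, rfl⟩
      · rcases Nat.eq_zero_or_pos ℓ with h0 | h0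
        · subst h0; simp at hn1
        · exact h0
      · rw [Nat.le_div_iff_mul_le hM0, mul_max_le_iff]
        exact ⟨hn'N, hnN⟩
  rw [hL, hR, himg]

/-! ### The diagonal over `S = [1, N'] × [1, N]` -/

/-- **Reindexing the whole diagonal.** For the index set `S = [1,N'] × [1,N]` of pairs `(n, h)` with
frequency `μ_{(n,h)} = nh`:
`Σ_{i ∈ S} Σ_{j ∈ S, μ_j = μ_i} Φ(i, j) = Σ_{h,k ≤ N} Σ_{1 ≤ ℓ ≤ N'/max(h',k')} Φ((ℓk', h), (ℓh', k))`
(`h' = h/(h,k)`, `k' = k/(h,k)`). [cite: Levinson1974, §4] -/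
theorem sum_coincidence_reindex {α : Type*} [AddCommMonoid α] (N N' : ℕ)
    (Φ : ℕ × ℕ → ℕ × ℕ → α) :
    ∑ i ∈ (Finset.Icc 1 N') ×ˢ (Finset.Icc 1 N),
        ∑ j ∈ ((Finset.Icc 1 N') ×ˢ (Finset.Icc 1 N)).filter (fun j => j.1 * j.2 = i.1 * i.2),
          Φ i j =
      ∑ h ∈ Finset.Icc 1 N, ∑ k ∈ Finset.Icc 1 N,
        ∑ ℓ ∈ Finset.Icc 1 (N' / max (h / Nat.gcd h k) (k / Nat.gcd h k)),
          Φ (ℓ * (k / Nat.gcd h k), h) (ℓ * (h / Nat.gcd h k), k) := by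
  -- unfold the filtered inner sum into `ite`s and split the products
  have step1 : ∀ i : ℕ × ℕ,
      ∑ j ∈ ((Finset.Icc 1 N') ×ˢ (Finset.Icc 1 N)).filter (fun j => j.1 * j.2 = i.1 * i.2), Φ i j =
        ∑ k ∈ Finset.Icc 1 N, ∑ n' ∈ (Finset.Icc 1 N').filter (fun n' => n' * k = i.1 * i.2),
          Φ i (n', k) := by
    intro i
    rw [Finset.sum_filter, Finset.sum_product_right]
    refine Finset.sum_congr rfl fun k _ => ?_
    rw [Finset.sum_filter]
  simp_rw [step1]
  rw [Finset.sum_product_right]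
  refine Finset.sum_congr rfl fun h hh => ?_
  rw [Finset.sum_comm]
  refine Finset.sum_congr rfl fun k hk => ?_
  have hh0 : 0 < h := (Finset.mem_Icc.1 hh).1
  have hk0 : 0 < k := (Finset.mem_Icc.1 hk).1
  exact sum_sum_filter_coincidence_eq hh0 hk0 N' (fun n n' => Φ (n, h) (n', k))

/-! ### The coefficients `x_{(n,h)} = a_h (nh)^{-1/2}` -/

/-- The coefficient `x_{(n,h)} = a_h · (nh)^{-1/2}` of the activated Dirichlet polynomial
`(Σ_{n ≤ √(t/2π)} n^{-1/2-it}) · A(½+it)` at the frequency `nh`. [cite: Titchmarsh1986, §7.4] -/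
def diagCoeff (a : ℕ → ℂ) (i : ℕ × ℕ) : ℂ :=
  a i.2 * ((((i.1 * i.2 : ℕ) : ℝ) ^ (-(1 / 2 : ℝ)) : ℝ) : ℂ)

/-- Unfolding `diagCoeff`. [folklore] -/
theorem diagCoeff_apply (a : ℕ → ℂ) (n h : ℕ) :
    diagCoeff a (n, h) = a h * ((((n * h : ℕ) : ℝ) ^ (-(1 / 2 : ℝ)) : ℝ) : ℂ) := rfl

/-- `ℓ k' h = ℓ [h, k]` (`k' = k/(h,k)`): the common frequency of a coincidence. [folklore] -/
theorem mul_div_gcd_mul_eq_lcm (h k ℓ : ℕ) : ℓ * (k / Nat.gcd h k) * h = ℓ * Nat.lcm h k := by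
  rw [Nat.lcm, mul_assoc]
  congr 1
  rw [mul_comm, ← Nat.mul_div_assoc h (Nat.gcd_dvd_right h k)]

/-- `ℓ h' k = ℓ [h, k]` (`h' = h/(h,k)`). [folklore] -/
theorem mul_div_gcd_mul_eq_lcm' (h k ℓ : ℕ) : ℓ * (h / Nat.gcd h k) * k = ℓ * Nat.lcm h k := by
  rw [Nat.lcm_comm, ← mul_div_gcd_mul_eq_lcm k h ℓ, Nat.gcd_comm]

/-- `m^{-1/2} · m^{-1/2} = 1/m` for `m > 0`. [folklore] -/
theorem rpow_neg_half_mul_self {m : ℝ} (hm : 0 < m) :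
    m ^ (-(1 / 2 : ℝ)) * m ^ (-(1 / 2 : ℝ)) = 1 / m := by
  rw [← Real.rpow_add hm, show (-(1 / 2 : ℝ)) + -(1 / 2) = -1 by norm_num, Real.rpow_neg_one,
    one_div]

/-- **The diagonal coefficient of a coincidence**: for `h, k, ℓ ≥ 1`,
`x_{(ℓk', h)} · conj x_{(ℓh', k)} = a_h ā_k / (ℓ [h,k])`. [cite: Titchmarsh1986, §7.4] -/
theorem diagCoeff_mul_conj (a : ℕ → ℂ) {h k ℓ : ℕ} (hh : 0 < h) (hk : 0 < k) (hℓ : 0 < ℓ) :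
    diagCoeff a (ℓ * (k / Nat.gcd h k), h) * conj (diagCoeff a (ℓ * (h / Nat.gcd h k), k)) =
      a h * conj (a k) / ((ℓ : ℂ) * (Nat.lcm h k : ℂ)) := by
  rw [diagCoeff_apply, diagCoeff_apply, mul_div_gcd_mul_eq_lcm, mul_div_gcd_mul_eq_lcm']
  have hm : 0 < ((ℓ * Nat.lcm h k : ℕ) : ℝ) := by
    exact_mod_cast Nat.mul_pos hℓ (Nat.lcm_pos hh hk)
  rw [map_mul, Complex.conj_ofReal]
  have e : ((((ℓ * Nat.lcm h k : ℕ) : ℝ) ^ (-(1 / 2 : ℝ)) : ℝ) : ℂ) *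
      ((((ℓ * Nat.lcm h k : ℕ) : ℝ) ^ (-(1 / 2 : ℝ)) : ℝ) : ℂ) = 1 / ((ℓ : ℂ) * (Nat.lcm h k : ℂ)) := by
    rw [← Complex.ofReal_mul, rpow_neg_half_mul_self hm]
    push_cast
    ring
  calc a h * ((((ℓ * Nat.lcm h k : ℕ) : ℝ) ^ (-(1 / 2 : ℝ)) : ℝ) : ℂ) *
        (conj (a k) * ((((ℓ * Nat.lcm h k : ℕ) : ℝ) ^ (-(1 / 2 : ℝ)) : ℝ) : ℂ))
      = a h * conj (a k) * (((((ℓ * Nat.lcm h k : ℕ) : ℝ) ^ (-(1 / 2 : ℝ)) : ℝ) : ℂ) *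
          ((((ℓ * Nat.lcm h k : ℕ) : ℝ) ^ (-(1 / 2 : ℝ)) : ℝ) : ℂ)) := by ring
    _ = a h * conj (a k) / ((ℓ : ℂ) * (Nat.lcm h k : ℂ)) := by rw [e]; ring

/-- **The activation window of a coincidence**: `max(2π(ℓk')², 2π(ℓh')²) = 2πℓ²M²`,
`M = max(h', k')`. [folklore] -/
theorem max_activation_eq (h' k' ℓ : ℕ) :
    max (2 * Real.pi * (((ℓ * k' : ℕ)) : ℝ) ^ 2) (2 * Real.pi * (((ℓ * h' : ℕ)) : ℝ) ^ 2) =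
      2 * Real.pi * (ℓ : ℝ) ^ 2 * ((max h' k' : ℕ) : ℝ) ^ 2 := by
  have hπ : 0 ≤ 2 * Real.pi := by positivity
  rcases le_total h' k' with hle | hle
  · rw [max_eq_right hle, max_eq_left]
    · push_cast; ring
    · have : ((ℓ * h' : ℕ) : ℝ) ≤ ((ℓ * k' : ℕ) : ℝ) := by exact_mod_cast Nat.mul_le_mul_left ℓ hle
      exact mul_le_mul_of_nonneg_left (pow_le_pow_left₀ (Nat.cast_nonneg _) this 2) hπ
  · rw [max_eq_left hle, max_eq_right]
    · push_cast; ring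
    · have : ((ℓ * k' : ℕ) : ℝ) ≤ ((ℓ * h' : ℕ) : ℝ) := by exact_mod_cast Nat.mul_le_mul_left ℓ hle
      exact mul_le_mul_of_nonneg_left (pow_le_pow_left₀ (Nat.cast_nonneg _) this 2) hπ

/-! ### The diagonal in closed form -/

/-- **The diagonal of `∫_T^{2T} |Σ_{n ≤ √(t/2π)} n^{-1/2-it} · A(½+it)|² dt` in closed form.** With
`S = [1,N'] × [1,N]`, `x_{(n,h)} = a_h (nh)^{-1/2}`, `μ_{(n,h)} = nh`, and the window
`∫_T^{2T}[2πn² ≤ t][2πn'² ≤ t] dt = (2T − max(T, 2π max(n,n')²))⁺`: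
`Σ_{i ∈ S} Σ_{j ∈ S, μ_j = μ_i} x_i x̄_j (2T − max(T, max(2πn², 2πn'²)))⁺`
`  = Σ_{h,k ≤ N} (a_h ā_k/[h,k]) Σ_{1 ≤ ℓ ≤ N'/M_{hk}} (2T − max(T, 2πℓ²M_{hk}²))⁺/ℓ`,
`M_{hk} = max(h/(h,k), k/(h,k))` — the inner sum being the diagonal sum `D_{N'/M}(M, T)` of
`Literature/NumberTheory/LFunctions/BCHDiagonalSum.lean`. [cite: Titchmarsh1986, §7.4] -/
theorem sum_coincidence_diag_eq (a : ℕ → ℂ) (N N' : ℕ) (T : ℝ) :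
    ∑ i ∈ (Finset.Icc 1 N') ×ˢ (Finset.Icc 1 N),
        ∑ j ∈ ((Finset.Icc 1 N') ×ˢ (Finset.Icc 1 N)).filter (fun j => j.1 * j.2 = i.1 * i.2),
          diagCoeff a i * conj (diagCoeff a j) *
            ((max (2 * T - max T (max (2 * Real.pi * (i.1 : ℝ) ^ 2) (2 * Real.pi * (j.1 : ℝ) ^ 2))) 0
              : ℝ) : ℂ) =
      ∑ h ∈ Finset.Icc 1 N, ∑ k ∈ Finset.Icc 1 N,
        a h * conj (a k) / (Nat.lcm h k : ℂ) *
          ((∑ ℓ ∈ Finset.Icc 1 (N' / max (h / Nat.gcd h k) (k / Nat.gcd h k)),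
              max (2 * T - max T (2 * Real.pi * (ℓ : ℝ) ^ 2 *
                ((max (h / Nat.gcd h k) (k / Nat.gcd h k) : ℕ) : ℝ) ^ 2)) 0 / ℓ : ℝ) : ℂ) := by
  rw [sum_coincidence_reindex]
  refine Finset.sum_congr rfl fun h hh => Finset.sum_congr rfl fun k hk => ?_
  have hh0 : 0 < h := (Finset.mem_Icc.1 hh).1
  have hk0 : 0 < k := (Finset.mem_Icc.1 hk).1
  rw [Complex.ofReal_sum, Finset.mul_sum]
  refine Finset.sum_congr rfl fun ℓ hℓ => ?_
  have hℓ0 : 0 < ℓ := (Finset.mem_Icc.1 hℓ).1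
  rw [diagCoeff_mul_conj a hh0 hk0 hℓ0]
  -- the window: `max(2π(ℓk')², 2π(ℓh')²) = 2πℓ²M²`
  have hwin := max_activation_eq (h / Nat.gcd h k) (k / Nat.gcd h k) ℓ
  rw [hwin, max_comm (h / Nat.gcd h k) (k / Nat.gcd h k)]
  have hℓC : (ℓ : ℂ) ≠ 0 := by exact_mod_cast hℓ0.ne'
  have hLC : (Nat.lcm h k : ℂ) ≠ 0 := by exact_mod_cast (Nat.lcm_pos hh0 hk0).ne'
  push_cast
  field_simp

end Literature.NumberTheory.LFunctions.BCH
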